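import Mathlib
import Summits.Ventures.HodgeRepro0.P8ProductTwoOrbitFacts
/-!
# P8ProductNoHodgePair — THE LATTICE FACT (a) OF THEOREM S (proofs/P8-ProductLatticeCensus-v1.2.md §1′): NO ι-FREE HODGE SET OF SIZE 2 ON B₀ × A′
— the balanced 2-subsets of `Σ = Σ_{B₀} ⊔ Σ_{A′}` are exactly the conjugate pairs `{s, −s}`, so `Λ₁ = Π` (Proposition R (i) for size 2), kernel-checked

p8 (g24), 2026-08-29. Supporting artefact (R-5): finite combinatorics only, never frozen, nothing declared uses it. NOTHING here is an
algebraicity statement. Setting: P8ProductTwoOrbitFacts (p713921): `balP SB SA` = the balance test of the subset `SB ⊔ SA` of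
`(ℤ/32)^× ⊔ (ℤ/96)^×` for the product type `Φ₀ ⊔ T′` at all 32 units (`2·|g·S ∩ Φ| = |S|` for every `g`); `unitG` the 32 units of ℤ/96.

## What is checked
`unitB` lists the 16 units of ℤ/32. THEOREMS (`decide +kernel`): `no_pair_BB` — for units `u ≠ v` of ℤ/32 with `v ≠ −u`, the set `{u, v} ⊂ Σ_{B₀}`
is NOT balanced; `no_pair_AA` — the same in `Σ_{A′}` for units of ℤ/96; `no_pair_BA` — no cross pair `{u} ⊔ {v}` is balanced. Hence every
Hodge set of size 2 of the product is a conjugate pair `{s, ιs}` (which is balanced: `pair_balanced`), i.e. the lattice fact (a): `Λ₁ = Π`.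
Every theorem is a `decide +kernel` evaluation (kernel reduction, no extra axiom). What the kernel does NOT check: the identification of
`Λ₁` with the lattice of the size-≤ 2 contents (the lattice page's definition), anything about sizes ≥ 4 (the census), (X9) and its inputs. Nothing here asserts anything about whether the statement of README §1 has been proved elsewhere.
-/

namespace HodgeRepro0.P8ProductNoHodgePair
open HodgeRepro0.P8ProductTwoOrbitFacts

/-- The 16 units of ℤ/32 in increasing order. -/
def unitB : Fin 16 → ℕ := ![1, 3, 5, 7, 9, 11, 13, 15, 17, 19, 21, 23, 25, 27, 29, 31]

/-- No ι-free 2-subset of `Σ_{B₀}` is balanced. -/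
theorem no_pair_BB : ∀ s t : Fin 16, unitB t ≠ unitB s → unitB t ≠ (32 - unitB s) % 32 → balP [unitB s, unitB t] [] = false := by
  decide +kernel

/-- No ι-free 2-subset of `Σ_{A′}` is balanced. -/
theorem no_pair_AA : ∀ s t : Fin 32, unitG t ≠ unitG s → unitG t ≠ (96 - unitG s) % 96 → balP [] [unitG s, unitG t] = false := by
  decide +kernel

/-- No cross pair (one element on each side) is balanced. -/
theorem no_pair_BA : ∀ s : Fin 16, ∀ t : Fin 32, balP [unitB s] [unitG t] = false := by decide +kernel

/-- Every conjugate pair is balanced (on either side). -/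
theorem pair_balanced : (∀ s : Fin 16, balP [unitB s, (32 - unitB s) % 32] [] = true) ∧
    (∀ s : Fin 32, balP [] [unitG s, (96 - unitG s) % 96] = true) := by decide +kernel

/-- THE LATTICE FACT (a): a 2-subset of `Σ` is balanced iff it is a conjugate pair — on the B₀-side, on the A′-side, and never across. -/
theorem hodge_pairs_are_conjugate :
    (∀ s t : Fin 16, unitB t ≠ unitB s → (balP [unitB s, unitB t] [] = true ↔ unitB t = (32 - unitB s) % 32)) ∧
    (∀ s t : Fin 32, unitG t ≠ unitG s → (balP [] [unitG s, unitG t] = true ↔ unitG t = (96 - unitG s) % 96)) ∧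
    (∀ s : Fin 16, ∀ t : Fin 32, balP [unitB s] [unitG t] = false) := by
  refine ⟨fun s t hne => ⟨fun hb => ?_, fun he => ?_⟩, fun s t hne => ⟨fun hb => ?_, fun he => ?_⟩, no_pair_BA⟩
  · by_contra h; have := no_pair_BB s t hne h; rw [hb] at this; exact Bool.noConfusion this
  · rw [he]; exact pair_balanced.1 s
  · by_contra h; have := no_pair_AA s t hne h; rw [hb] at this; exact Bool.noConfusion this
  · rw [he]; exact pair_balanced.2 s

end HodgeRepro0.P8ProductNoHodgePair
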